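import Summits.PneNP.PneNP.Theorems.PairwiseSALinear
import Summits.PneNP.PneNP.Theorems.QuotientSABlockLaws
import Summits.PneNP.PneNP.Theorems.QuotientSABlockRange
import Summits.PneNP.PneNP.Theorems.QuotientSABlockExist

/-!
# HEADLINE-22: Sherali–Adams stays blind on pure-`P⋆` avoidance AFTER the exact XOR quotient (cell `pnp-ideate`, ROUND-22)

FRONTIER range-avoidance ladder, rung F-N3 context (restricted-model lower bound for the Sherali–Adams hierarchy) — nothing here
bears on `P` vs `NP`.

`saAfterQuotientBlind : QuotientSAHeadline.SAAfterQuotientBlind`, assembled BY NAME from the four suppliers of p3's wiring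
`QuotientSABlocks.saAfterQuotientBlind_of`:

* the biased-BGMT hub `PairwiseSA.pairwiseSALinearLevel` (T22.0, prover-2), applied at BLOCK granularity (arity `K = (s+1)s`,
  ratio `(2K−5)/2 > K − 3`);
* the block laws `QuotientSABlockLaws.blockLaws` (T22.1a(ii), prover-1: the biased product law conditioned on a coset of
  `Cut(K_{s+1})` is pairwise independent — `Cut^⊥ = Cycle` has minimum weight `3`);
* the per-block cycle bridge `QuotientSABlockRange.blockRange` (B2, p3: `y ∈ Range(pstar A) ↔ π y ∈ Range(quot A)`);
* the existence of expanding clean block systems `QuotientSABlockExist.blockExpandExist` (B3, p3 model + prover-2 counting).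

Reading: at every stretch `C` there is `c > 0` such that for infinitely many `n` some pure-`P⋆` instance with `C·n ≤ m` outputs
has a point outside its range, an EXACT XOR-linear quotient onto a pure-`IP₃` `6`-local map `Φ` on `≤ n` variables with
`≥ m − n` outputs (`y ∈ Range I ↔ π y ∈ Range Φ`), and `Φ` is Sherali–Adams feasible at level `n / c` for EVERY target:
linear-level SA cannot solve `P⋆` avoidance even after exact elimination of the XOR layer (cell memo §11/§12: this one is not
of Grigoriev type).  By `QuotientSAHeadline.saAfterQuotientBlind_ip3` it implies COR-A.
-/

set_option linter.dupNamespace false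

namespace Summit.PneNP.PneNP.Theorems.QuotientSAHeadline

/-- **HEADLINE-22 (ROUND-22).**  Linear-level Sherali–Adams is blind on pure-`P⋆` range avoidance even after the exact
XOR-linear quotient to a pure-`IP₃` system.  Restricted-model lower bound for a relaxation hierarchy; it says nothing about
`P` versus `NP`. -/
theorem saAfterQuotientBlind : SAAfterQuotientBlind :=
  QuotientSABlocks.saAfterQuotientBlind_of PairwiseSA.pairwiseSALinearLevel QuotientSABlockLaws.blockLaws
    QuotientSABlockRange.blockRange QuotientSABlockExist.blockExpandExist

end Summit.PneNP.PneNP.Theorems.QuotientSAHeadline
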